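import Mathlib.Analysis.Convex.Jensen
import Mathlib.Analysis.Convex.SpecificFunctions.Basic
import Mathlib.Analysis.SpecialFunctions.Log.Basic
import HarnessLib

/-!
# The one-sided free-energy estimator is biased UP, so the two-sided sum `F̂₀₁ + F̂₁₀` has a nonnegative mean

HONEST FRAMING: exact (Metropolis-corrected) sampling algorithms for lattice gauge theory;
figures of merit are autocorrelation/cost numbers at stated couplings and volumes; no
continuum-physics claim.

Venture `LatticeQCDFlow` (cell pub-lqcd), sub-topic `Scoring`; FANOUT row 11 (`eng-scorerA`,
fitness scorer A), GEN-12.  NEW WORK of the cell (placement rule): finite-law Jensen arithmetic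
behind the LEADERBOARD-2 docket item L2-A15 (c) — the arbiter's RULING 4
(HOME/ref-exact/ARBITRATION-L2-A15-c.md): on a non-equilibrium chain set that declares an exact
time-reversed partner, the two one-sided Jarzynski estimates `F̂₀₁ = −log mean e^{−W_f}` and
`F̂₁₀ = −log mean e^{−W_r}` must satisfy `F₀₁ + F₁₀ = 0`, tested HARD as
`z = |F̂₀₁ + F̂₁₀| / σ_jk > 3`, with precondition Q3 'jackknife bias printed; > σ/3 ⇒ WARN'.
Nothing here is a published result cited as a tree fact (the inequality is Jensen's; the
printed counterpart of the remark is e.g. Zuckerman–Woolf, Phys. Rev. Lett. 89 (2002) 180602,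
named in this docstring only).

## What is typed (finite outcome set `Ω`, law `P ≥ 0`, `Σ P = 1`; expectations are finite sums)

* `neg_log_finExpect_le` — Jensen for `−log`: `−log E[f] ≤ E[−log f]` for `f > 0`, and the strict
  form `neg_log_finExpect_lt_iff` (strict iff `f` takes two different values on the support of `P`).
* `finExpect_weightMean` — if each of the `n` importance weights `e^{−W_i}` has mean `r` (for a
  Jarzynski protocol `r = Z₁/Z₀`, `Exactness.JarzynskiFinite.jarzynski`; NO independence or
  identical distribution of the `W_i` is assumed — consecutive evolutions off one prior chain are
  fine), the sample-mean weight has mean `r`.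
* **`le_finExpect_jarzynskiEstimate`** — hence `E[F̂] ≥ −log r = ΔF`: the one-sided estimator
  over-estimates the free-energy difference IN ITS OWN DIRECTION at every finite `n`, whatever the
  dependence between the works; `lt_finExpect_jarzynskiEstimate_iff`: strictly unless the
  sample-mean weight is `P`-a.s. constant.
* **`finExpect_twoSided_sum_nonneg`** — for a forward family with weight mean `r` and a reverse
  family with weight mean `r⁻¹` (the partner protocol: `Z₀/Z₁`):
  `E[F̂₀₁ + F̂₁₀] ≥ −log r − log r⁻¹ = 0`.

## Reading for the scorer (L2-A15 (c) pen, both implementations)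

The NULL expectation of the numerator of Ruling 4's `z` is not `0` but the SUM of the two Jensen
gaps, each `≥ 0`: an honest pair prints a POSITIVE `F̂₀₁ + F̂₁₀` on average at finite `n` (row 23's
D0 two-sided read, HOME/su3-dsnf-a/TWOSIDED-D0-Ld2.md §1: forward − reverse-implied = +0.24,
z +2.2…+2.9 per arm, 'the gap is the SUM of two positive finite-n biases plus noise').  So the HARD
test needs Q3 as ruled — the delete-one-replica jackknife bias of EACH arm printed and the WARN when
it exceeds `σ/3` — or a bias-corrected numerator; a one-signed mean shift is otherwise read as a
`3σ` identity failure on a long enough honest run.  What is NOT here: the size of the gap (second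
order `≈ Var(mean w)/(2 r²)`; law-dependent) and anything about `σ_jk`.
-/

namespace Summit.Ventures.LatticeQCDFlow.Scoring

open Real Finset

variable {Ω : Type*} [Fintype Ω]

/-! ### Jensen for `−log` under a finite law -/

/-- Expectation of `f` under the finite law `P` on `Ω`: `E[f] = Σ_ω P(ω) f(ω)`. -/
def finExpect (P : Ω → ℝ) (f : Ω → ℝ) : ℝ := ∑ ω, P ω * f ω

/-- Linearity: `E[f + g] = E[f] + E[g]`. -/
theorem finExpect_add (P f g : Ω → ℝ) :
    finExpect P (fun ω => f ω + g ω) = finExpect P f + finExpect P g := by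
  unfold finExpect
  rw [← sum_add_distrib]
  exact sum_congr rfl fun ω _ => by ring

/-- `E[c] = c` for a law of total mass one. -/
theorem finExpect_const (P : Ω → ℝ) (hP1 : ∑ ω, P ω = 1) (c : ℝ) :
    finExpect P (fun _ => c) = c := by
  unfold finExpect
  rw [← sum_mul, hP1, one_mul]

/-- Monotonicity: `f ≤ g` pointwise ⇒ `E[f] ≤ E[g]` (for `P ≥ 0`). -/
theorem finExpect_mono (P : Ω → ℝ) (hP0 : ∀ ω, 0 ≤ P ω) {f g : Ω → ℝ} (hfg : ∀ ω, f ω ≤ g ω) :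
    finExpect P f ≤ finExpect P g := by
  unfold finExpect
  exact sum_le_sum fun ω _ => mul_le_mul_of_nonneg_left (hfg ω) (hP0 ω)

/-- **Jensen for `−log`:** for a positive `f`, `−log E[f] ≤ E[−log f]`. -/
theorem neg_log_finExpect_le (P : Ω → ℝ) (hP0 : ∀ ω, 0 ≤ P ω) (hP1 : ∑ ω, P ω = 1)
    {f : Ω → ℝ} (hf : ∀ ω, 0 < f ω) :
    -Real.log (finExpect P f) ≤ finExpect P (fun ω => -Real.log (f ω)) := by
  have h := strictConcaveOn_log_Ioi.concaveOn.le_map_sum (t := Finset.univ) (w := P) (p := f)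
    (fun i _ => hP0 i) hP1 (fun i _ => Set.mem_Ioi.mpr (hf i))
  simp only [smul_eq_mul] at h
  have hneg : finExpect P (fun ω => -Real.log (f ω)) = -∑ ω, P ω * Real.log (f ω) := by
    unfold finExpect
    rw [← sum_neg_distrib]
    exact sum_congr rfl fun ω _ => by ring
  rw [hneg]
  unfold finExpect
  exact neg_le_neg h

/-- **Strict Jensen for `−log`:** the inequality is strict iff `f` takes two different values at
outcomes of nonzero probability. -/
theorem neg_log_finExpect_lt_iff (P : Ω → ℝ) (hP0 : ∀ ω, 0 ≤ P ω) (hP1 : ∑ ω, P ω = 1)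
    {f : Ω → ℝ} (hf : ∀ ω, 0 < f ω) :
    -Real.log (finExpect P f) < finExpect P (fun ω => -Real.log (f ω))
      ↔ ∃ ω ω', P ω ≠ 0 ∧ P ω' ≠ 0 ∧ f ω ≠ f ω' := by
  have h := strictConcaveOn_log_Ioi.lt_map_sum_iff_of_nonneg (t := Finset.univ) (w := P) (p := f)
    (fun i _ => hP0 i) hP1 (fun i _ => Set.mem_Ioi.mpr (hf i))
  simp only [smul_eq_mul, Finset.mem_univ, true_and] at h
  have hneg : finExpect P (fun ω => -Real.log (f ω)) = -∑ ω, P ω * Real.log (f ω) := by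
    unfold finExpect
    rw [← sum_neg_distrib]
    exact sum_congr rfl fun ω _ => by ring
  rw [hneg]
  unfold finExpect
  rw [neg_lt_neg_iff]
  exact h

/-! ### The one-sided Jarzynski estimator -/

/-- The sample mean of the importance weights of `n` work values: `(1/n) Σ_i e^{−W_i}`. -/
noncomputable def weightMean {n : ℕ} (W : Fin n → ℝ) : ℝ := (∑ i, Real.exp (-W i)) / n

/-- The one-sided Jarzynski free-energy estimate `F̂ = −log ((1/n) Σ_i e^{−W_i})`. -/
noncomputable def jarzynskiEstimate {n : ℕ} (W : Fin n → ℝ) : ℝ := -Real.log (weightMean W)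

/-- The sample-mean weight is positive (`n ≥ 1`). -/
theorem weightMean_pos {n : ℕ} (hn : 0 < n) (W : Fin n → ℝ) : 0 < weightMean W := by
  unfold weightMean
  have : Nonempty (Fin n) := ⟨⟨0, hn⟩⟩
  exact div_pos (sum_pos (fun i _ => Real.exp_pos _) univ_nonempty) (by exact_mod_cast hn)

/-- If every weight `e^{−W_i}` has mean `r` under `P` (Jarzynski: `r = Z₁/Z₀`, whatever the
dependence between the `W_i`), the sample-mean weight has mean `r`. -/
theorem finExpect_weightMean {n : ℕ} (hn : 0 < n) (P : Ω → ℝ) (W : Fin n → Ω → ℝ) (r : ℝ)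
    (hmean : ∀ i, finExpect P (fun ω => Real.exp (-W i ω)) = r) :
    finExpect P (fun ω => weightMean (fun i => W i ω)) = r := by
  unfold weightMean
  unfold finExpect at hmean ⊢
  have hn' : (n : ℝ) ≠ 0 := by exact_mod_cast hn.ne'
  have h1 : ∀ ω, P ω * ((∑ i, Real.exp (-W i ω)) / n)
      = (∑ i, P ω * Real.exp (-W i ω)) * (n : ℝ)⁻¹ := fun ω => by
    rw [div_eq_mul_inv, ← mul_assoc, Finset.mul_sum]
  rw [sum_congr rfl fun ω _ => h1 ω, ← Finset.sum_mul, Finset.sum_comm]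
  have h2 : ∑ i, ∑ ω, P ω * Real.exp (-W i ω) = ∑ _i : Fin n, r :=
    sum_congr rfl fun i _ => hmean i
  rw [h2, sum_const, card_univ, Fintype.card_fin, nsmul_eq_mul]
  field_simp

/-- **The one-sided estimator is biased UP:** `−log r ≤ E[F̂]` — at every finite `n` the Jarzynski
estimate over-estimates the free-energy difference in its own direction (`r = Z₁/Z₀`,
`−log r = ΔF`). -/
theorem le_finExpect_jarzynskiEstimate {n : ℕ} (hn : 0 < n) (P : Ω → ℝ) (hP0 : ∀ ω, 0 ≤ P ω)
    (hP1 : ∑ ω, P ω = 1) (W : Fin n → Ω → ℝ) (r : ℝ)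
    (hmean : ∀ i, finExpect P (fun ω => Real.exp (-W i ω)) = r) :
    -Real.log r ≤ finExpect P (fun ω => jarzynskiEstimate (fun i => W i ω)) := by
  rw [← finExpect_weightMean hn P W r hmean]
  exact neg_log_finExpect_le P hP0 hP1 fun ω => weightMean_pos hn _

/-- … and STRICTLY so unless the sample-mean weight is `P`-almost surely constant. -/
theorem lt_finExpect_jarzynskiEstimate_iff {n : ℕ} (hn : 0 < n) (P : Ω → ℝ) (hP0 : ∀ ω, 0 ≤ P ω)
    (hP1 : ∑ ω, P ω = 1) (W : Fin n → Ω → ℝ) (r : ℝ)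
    (hmean : ∀ i, finExpect P (fun ω => Real.exp (-W i ω)) = r) :
    -Real.log r < finExpect P (fun ω => jarzynskiEstimate (fun i => W i ω))
      ↔ ∃ ω ω', P ω ≠ 0 ∧ P ω' ≠ 0
          ∧ weightMean (fun i => W i ω) ≠ weightMean (fun i => W i ω') := by
  rw [← finExpect_weightMean hn P W r hmean]
  exact neg_log_finExpect_lt_iff P hP0 hP1 fun ω => weightMean_pos hn _

/-! ### The two-sided sum -/

/-- **`E[F̂₀₁ + F̂₁₀] ≥ 0`.**  Forward works `W` with weight mean `r` (`= Z₁/Z₀`) and reverse works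
`V` with weight mean `r⁻¹` (`= Z₀/Z₁`, the declared partner protocol): the two-sided sum, whose
population value is `F₀₁ + F₁₀ = −log r − log r⁻¹ = 0`, has NONNEGATIVE expectation — the sum of the
two one-sided Jensen gaps.  (Numbers of evolutions `n`, `m ≥ 1`; no independence assumed anywhere;
`r > 0` is not even needed for the arithmetic.) -/
theorem finExpect_twoSided_sum_nonneg {n m : ℕ} (hn : 0 < n) (hm : 0 < m) (P : Ω → ℝ)
    (hP0 : ∀ ω, 0 ≤ P ω) (hP1 : ∑ ω, P ω = 1) (W : Fin n → Ω → ℝ) (V : Fin m → Ω → ℝ)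
    (r : ℝ) (hW : ∀ i, finExpect P (fun ω => Real.exp (-W i ω)) = r)
    (hV : ∀ j, finExpect P (fun ω => Real.exp (-V j ω)) = r⁻¹) :
    0 ≤ finExpect P (fun ω =>
      jarzynskiEstimate (fun i => W i ω) + jarzynskiEstimate (fun j => V j ω)) := by
  rw [finExpect_add]
  have h1 := le_finExpect_jarzynskiEstimate hn P hP0 hP1 W r hW
  have h2 := le_finExpect_jarzynskiEstimate hm P hP0 hP1 V r⁻¹ hV
  have h0 : -Real.log r + -Real.log r⁻¹ = 0 := by
    rw [Real.log_inv]
    ring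
  linarith

/-- The population identity being tested: with `F₀₁ = −log r` and `F₁₀ = −log r⁻¹`,
`F₀₁ + F₁₀ = 0`. -/
theorem twoSided_population_sum_eq_zero (r : ℝ) : -Real.log r + -Real.log r⁻¹ = 0 := by
  rw [Real.log_inv]
  ring

/-- **Each gap separately:** the forward gap `E[F̂₀₁] − F₀₁` and the reverse gap `E[F̂₁₀] − F₁₀` are
both `≥ 0`, and the expected two-sided sum IS their sum. -/
theorem finExpect_twoSided_sum_eq_gaps {n m : ℕ} (P : Ω → ℝ) (W : Fin n → Ω → ℝ)
    (V : Fin m → Ω → ℝ) (r : ℝ) :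
    finExpect P (fun ω => jarzynskiEstimate (fun i => W i ω) + jarzynskiEstimate (fun j => V j ω))
      = (finExpect P (fun ω => jarzynskiEstimate (fun i => W i ω)) - -Real.log r)
        + (finExpect P (fun ω => jarzynskiEstimate (fun j => V j ω)) - -Real.log r⁻¹) := by
  rw [finExpect_add, Real.log_inv]
  ring

end Summit.Ventures.LatticeQCDFlow.Scoring
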